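import Literature.NumberTheory.Sieve.CFSemigroupTransfer
import Literature.NumberTheory.Sieve.CFSemigroupPowFamily
import HarnessLib

/-!
# Non-local integrability (NLI) of the distortion function of the continued-fractions semigroup

[MageeOhWinter2019, §4.1, Defn. 19 and Prop. 20]. For the expanding map `T` of the boundary coding of `Γ_A`
(`T|_{I_a} = g_a^{-1}`, `g_a(x) = 1/(x + a)`, tree: `cfMoeb (cfGen a) x = 1/(x + a)`), with distortion function
`τ = log |T'|`, i.e. `τ(y) = -2 log y` (`T(y) = 1/y - a` on `I_a`), Magee–Oh–Winter (following Naud) define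
for a past `ξ ∈ Σ_A^-` the function
`Δ_ξ(u, v) = Σ_{i ≥ 0} [τ(T_{ξ_{-i}}^{-1} ∘ ⋯ ∘ T_{ξ_0}^{-1} u) - τ(T_{ξ_{-i}}^{-1} ∘ ⋯ ∘ T_{ξ_0}^{-1} v)]`,
the **temporal distance function** `φ_{ξ,η}(u, v) = Δ_ξ(u, v) - Δ_η(u, v)`, and say that `τ` has property
**(NLI)** if `∂φ_{ξ,η}/∂u (u₀, v₀) ≠ 0` for some `ξ, η, u₀, v₀` [Defn. 19]; Prop. 20 asserts (NLI) for the
continued-fractions semigroups, the proof being deferred to "Naud's argument" (two hyperbolic generators with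
distinct fixed points). This is the geometric input of the Dolgopyat estimate [MageeOhWinter2019, Thm. 4(2),
Prop. 21].

This file PROVES Prop. 20 for the CF semigroup on any two letters `a ≠ b` (`a, b ≥ 1`), with the constant pasts
`ξ = (…, a, a, a)`, `η = (…, b, b, b)` (admissible: the CF coding is a full shift), in closed form:

* `cfDelta a u v = Δ_ξ(u, v) = Σ_i [τ(g_a^{i+1} u) - τ(g_a^{i+1} v)]` converges for `u, v ∈ [0, 1]`
  (`summable_cfDelta`; the orbits `g_a^i u`, `g_a^i v` merge geometrically, `abs_iterate_sub_le`), and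
  **`Δ_ξ(u, v) = 2 log (u - ω_a^*) - 2 log (v - ω_a^*)`** (`cfDelta_eq`), where
  `ω_a^* = (-a - √(a² + 4))/2 < -1` is the repelling fixed point of `g_a` (`cfOmegaStar`): the series
  telescopes through `g_a x - ω_a^* = (-ω_a^*)(x - ω_a^*)/(x + a)` (`cfBr_sub_cfOmegaStar`);
* hence `φ_{ξ,η}(u, v) = 2 log((u-ω_a^*)(v-ω_b^*)/((v-ω_a^*)(u-ω_b^*)))` (a cross-ratio, `cfTemporal_eq`),
  `∂φ/∂u = 2/(u - ω_a^*) - 2/(u - ω_b^*)` (`hasDerivWithinAt_cfTemporal`), which vanishes nowhere on `[0, 1]`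
  when `a ≠ b` (`cfTemporal_deriv_ne_zero`): **(NLI) holds at every `(u₀, v₀)`** (`cfNLI`, `cfNLI_of_two_le_card`).

## References
* [MageeOhWinter2019] M. Magee, H. Oh, D. Winter, *Uniform congruence counting for Schottky semigroups in
  SL₂(ℤ)*, J. reine angew. Math. 753 (2019), 89–135, §4.1 Defn. 19, Prop. 20.
* F. Naud, *Expanding maps on Cantor sets and analytic continuation of zeta functions*, Ann. Sci. ÉNS 38
  (2005), 116–153, §2 (NLI via distinct fixed points).
-/

noncomputable section

open Set Filter Topology

namespace Literature.NumberTheory.Sieve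

/-! ### The branch `g_a(x) = 1/(x + a)` on `[0, 1]` and the merging of its orbits -/

/-- The inverse branch `g_a(x) = 1/(x + a)` of `T` (`= cfMoeb (cfGen a) x`). [cite: MageeOhWinter2019, §2.1] -/
def cfBr (a : ℕ) (x : ℝ) : ℝ := 1 / (x + a)

/-- `cfBr a` is the projective action of the generator `g_a`. [folklore] -/
theorem cfBr_eq_cfMoeb (a : ℕ) (x : ℝ) : cfBr a x = cfMoeb (cfGen a) x := (cfMoeb_cfGen a x).symm

section Branch

variable {a : ℕ} (ha : 1 ≤ a)
include ha

/-- `g_a x > 0` for `x ≥ 0`. [folklore] -/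
theorem cfBr_pos {x : ℝ} (hx : 0 ≤ x) : 0 < cfBr a x := by
  have : (1 : ℝ) ≤ a := by exact_mod_cast ha
  unfold cfBr; positivity

/-- `g_a x ≤ 1/a ≤ 1` for `x ≥ 0`. [folklore] -/
theorem cfBr_le_one {x : ℝ} (hx : 0 ≤ x) : cfBr a x ≤ 1 := by
  have : (1 : ℝ) ≤ a := by exact_mod_cast ha
  unfold cfBr
  rw [div_le_one (by linarith)]
  linarith

/-- `g_a` maps `[0, 1]` into itself. [folklore] -/
theorem cfBr_mem {x : ℝ} (hx : x ∈ Icc (0 : ℝ) 1) : cfBr a x ∈ Icc (0 : ℝ) 1 :=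
  ⟨(cfBr_pos ha hx.1).le, cfBr_le_one ha hx.1⟩

/-- The orbit `g_a^i x` stays in `[0, 1]`. [folklore] -/
theorem iterate_cfBr_mem {x : ℝ} (hx : x ∈ Icc (0 : ℝ) 1) (i : ℕ) : (cfBr a)^[i] x ∈ Icc (0 : ℝ) 1 := by
  induction i with
  | zero => simpa using hx
  | succ i ih => rw [Function.iterate_succ_apply']; exact cfBr_mem ha ih

/-- **Two-step contraction:** `g_a x · g_a (g_a x) = g_a x/(g_a x + a) ≤ 1/(1 + a) ≤ 1/2` for `x ≥ 0`.
[folklore] -/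
theorem cfBr_mul_cfBr_le {x : ℝ} (hx : 0 ≤ x) : cfBr a x * cfBr a (cfBr a x) ≤ 1 / 2 := by
  have h1 : (1 : ℝ) ≤ a := by exact_mod_cast ha
  have hy0 := cfBr_pos ha hx
  have hy1 := cfBr_le_one ha hx
  set y := cfBr a x
  have hya : 0 < y + a := by linarith
  rw [cfBr, mul_one_div, div_le_div_iff₀ hya (by norm_num : (0 : ℝ) < 2)]
  linarith

/-- The difference recursion `g_a x - g_a y = -(x - y) · g_a x · g_a y`. [folklore] -/
theorem cfBr_sub_cfBr {x y : ℝ} (hx : 0 ≤ x) (hy : 0 ≤ y) :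
    cfBr a x - cfBr a y = -(x - y) * (cfBr a x * cfBr a y) := by
  have h1 : (1 : ℝ) ≤ a := by exact_mod_cast ha
  have hxa : x + a ≠ 0 := by linarith
  have hya : y + a ≠ 0 := by linarith
  unfold cfBr
  field_simp
  ring

/-- **Orbits merge geometrically:** `|g_a^i x - g_a^i y| ≤ 2 (1/2)^i |x - y|` on `[0, 1]` (the eventually
expanding property of `T`, [MageeOhWinter2019, §2.1]). [folklore] -/
theorem abs_iterate_sub_le {x y : ℝ} (hx : x ∈ Icc (0 : ℝ) 1) (hy : y ∈ Icc (0 : ℝ) 1) (i : ℕ) :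
    |(cfBr a)^[i] x - (cfBr a)^[i] y| ≤ 2 * (1 / 2) ^ i * |x - y| := by
  induction i using Nat.strong_induction_on with
  | _ i ih =>
    match i with
    | 0 => simp; linarith [abs_nonneg (x - y)]
    | 1 =>
      simp only [Function.iterate_one, pow_one]
      rw [cfBr_sub_cfBr ha hx.1 hy.1, abs_mul, abs_neg, abs_of_nonneg (mul_nonneg (cfBr_pos ha hx.1).le
        (cfBr_pos ha hy.1).le)]
      have hp : cfBr a x * cfBr a y ≤ 1 := by
        have := cfBr_le_one ha hx.1; have := cfBr_le_one ha hy.1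
        have := (cfBr_pos ha hx.1).le; have := (cfBr_pos ha hy.1).le
        nlinarith
      nlinarith [abs_nonneg (x - y)]
    | i + 2 =>
      have hxi := iterate_cfBr_mem ha hx i
      have hyi := iterate_cfBr_mem ha hy i
      set x' := (cfBr a)^[i] x with hx'
      set y' := (cfBr a)^[i] y with hy'
      have hstep : (cfBr a)^[i + 2] x - (cfBr a)^[i + 2] y =
          (x' - y') * ((cfBr a x' * cfBr a (cfBr a x')) * (cfBr a y' * cfBr a (cfBr a y'))) := by
        rw [show i + 2 = (i + 1) + 1 from rfl, Function.iterate_succ_apply', Function.iterate_succ_apply',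
          Function.iterate_succ_apply', Function.iterate_succ_apply', ← hx', ← hy',
          cfBr_sub_cfBr ha (cfBr_pos ha hxi.1).le (cfBr_pos ha hyi.1).le, cfBr_sub_cfBr ha hxi.1 hyi.1]
        ring
      have hPx := cfBr_mul_cfBr_le ha hxi.1
      have hPy := cfBr_mul_cfBr_le ha hyi.1
      have hPx0 : 0 ≤ cfBr a x' * cfBr a (cfBr a x') :=
        mul_nonneg (cfBr_pos ha hxi.1).le (cfBr_pos ha (cfBr_pos ha hxi.1).le).le
      have hPy0 : 0 ≤ cfBr a y' * cfBr a (cfBr a y') :=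
        mul_nonneg (cfBr_pos ha hyi.1).le (cfBr_pos ha (cfBr_pos ha hyi.1).le).le
      have hI := ih i (by omega)
      rw [hstep, abs_mul, abs_of_nonneg (mul_nonneg hPx0 hPy0)]
      calc |x' - y'| * (cfBr a x' * cfBr a (cfBr a x') * (cfBr a y' * cfBr a (cfBr a y')))
          ≤ 2 * (1 / 2) ^ i * |x - y| * (1 / 2 * (1 / 2)) := by
            apply mul_le_mul hI (mul_le_mul hPx hPy hPy0 (by norm_num)) (mul_nonneg hPx0 hPy0)
            positivity
        _ = 2 * (1 / 2) ^ (i + 2) * |x - y| := by ring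

/-- In particular the orbits of any two points of `[0, 1]` merge: `g_a^i x - g_a^i y → 0`. [folklore] -/
theorem tendsto_iterate_sub {x y : ℝ} (hx : x ∈ Icc (0 : ℝ) 1) (hy : y ∈ Icc (0 : ℝ) 1) :
    Tendsto (fun i => (cfBr a)^[i] x - (cfBr a)^[i] y) atTop (𝓝 0) := by
  have hg : Tendsto (fun i : ℕ => 2 * (1 / 2 : ℝ) ^ i * |x - y|) atTop (𝓝 (2 * 0 * |x - y|)) :=
    ((tendsto_pow_atTop_nhds_zero_of_lt_one (by norm_num) (by norm_num)).const_mul 2).mul_const _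
  rw [mul_zero, zero_mul] at hg
  exact squeeze_zero_norm (fun i => abs_iterate_sub_le ha hx hy i) hg

end Branch

/-! ### The repelling fixed point `ω_a^*` of `g_a` -/

/-- The repelling fixed point `ω_a^* = (-a - √(a² + 4))/2` of `g_a` (the second root of `ω² + aω - 1 = 0`;
the attracting one is `[0; a, a, a, …]`). [folklore] -/
def cfOmegaStar (a : ℕ) : ℝ := (-(a : ℝ) - Real.sqrt ((a : ℝ) ^ 2 + 4)) / 2

/-- `ω_a^*` solves `ω² + aω - 1 = 0`. [folklore] -/
theorem cfOmegaStar_quadratic (a : ℕ) : cfOmegaStar a ^ 2 + a * cfOmegaStar a - 1 = 0 := by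
  have h := Real.sq_sqrt (show (0 : ℝ) ≤ (a : ℝ) ^ 2 + 4 by positivity)
  unfold cfOmegaStar
  nlinarith [h]

/-- `ω_a^* < -1` for `a ≥ 1`. [folklore] -/
theorem cfOmegaStar_lt {a : ℕ} (ha : 1 ≤ a) : cfOmegaStar a < -1 := by
  have h1 : (1 : ℝ) ≤ a := by exact_mod_cast ha
  have h2 : (2 : ℝ) ≤ Real.sqrt ((a : ℝ) ^ 2 + 4) := by
    rw [show (2 : ℝ) = Real.sqrt 4 by rw [show (4 : ℝ) = 2 ^ 2 by norm_num, Real.sqrt_sq (by norm_num)]]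
    exact Real.sqrt_le_sqrt (by nlinarith)
  unfold cfOmegaStar
  linarith

/-- `ω_a^*` is strictly decreasing in `a`; in particular `a ≠ b → ω_a^* ≠ ω_b^*`. [folklore] -/
theorem cfOmegaStar_strictAnti : StrictAnti cfOmegaStar := by
  intro a b hab
  have hab' : (a : ℝ) < b := by exact_mod_cast hab
  have hs : Real.sqrt ((a : ℝ) ^ 2 + 4) ≤ Real.sqrt ((b : ℝ) ^ 2 + 4) :=
    Real.sqrt_le_sqrt (by nlinarith [Nat.cast_nonneg (α := ℝ) a])
  show cfOmegaStar b < cfOmegaStar a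
  unfold cfOmegaStar
  linarith

/-- `ω_a^*` is a fixed point of `g_a`: `1/(ω_a^* + a) = ω_a^*`. [folklore] -/
theorem cfBr_cfOmegaStar (a : ℕ) : cfBr a (cfOmegaStar a) = cfOmegaStar a := by
  have hq := cfOmegaStar_quadratic a
  have hne : cfOmegaStar a + a ≠ 0 := by
    intro h
    have : cfOmegaStar a * (cfOmegaStar a + a) = 1 := by nlinarith [hq]
    rw [h, mul_zero] at this
    exact zero_ne_one this
  unfold cfBr
  field_simp
  nlinarith [hq]

/-- **The telescoping identity:** `g_a x - ω_a^* = (-ω_a^*) (x - ω_a^*)/(x + a)` for `x ≥ 0`. [folklore] -/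
theorem cfBr_sub_cfOmegaStar {a : ℕ} (ha : 1 ≤ a) {x : ℝ} (hx : 0 ≤ x) :
    cfBr a x - cfOmegaStar a = -cfOmegaStar a * (x - cfOmegaStar a) / (x + a) := by
  have h1 : (1 : ℝ) ≤ a := by exact_mod_cast ha
  have hq := cfOmegaStar_quadratic a
  have hxa : x + a ≠ 0 := by linarith
  unfold cfBr
  field_simp
  nlinarith [hq]

/-- Logarithmic form: `2 log (x + a) = 2 [log (-ω_a^*) + log (x - ω_a^*) - log (g_a x - ω_a^*)]` for `x ≥ 0`.
[folklore] -/
theorem two_log_add_eq {a : ℕ} (ha : 1 ≤ a) {x : ℝ} (hx : 0 ≤ x) :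
    2 * Real.log (x + a) = 2 * (Real.log (-cfOmegaStar a) + Real.log (x - cfOmegaStar a) -
      Real.log (cfBr a x - cfOmegaStar a)) := by
  have h1 : (1 : ℝ) ≤ a := by exact_mod_cast ha
  have hω := cfOmegaStar_lt ha
  have hxa : 0 < x + a := by linarith
  have hnum : 0 < -cfOmegaStar a * (x - cfOmegaStar a) := mul_pos (by linarith) (by linarith)
  rw [cfBr_sub_cfOmegaStar ha hx, Real.log_div hnum.ne' hxa.ne', Real.log_mul (by linarith) (by linarith)]
  ring

/-! ### The distortion function and `Δ_ξ` for a constant past -/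

/-- The distortion function `τ = log |T'|` of the CF coding: on `I_a`, `T(y) = 1/y - a`, `T'(y) = -1/y²`, so
`τ(y) = -2 log y`. [cite: MageeOhWinter2019, §2.1] -/
def cfTauFn (y : ℝ) : ℝ := -2 * Real.log y

/-- `τ(g_a x) = 2 log (x + a)`. [folklore] -/
theorem cfTauFn_cfBr (a : ℕ) (x : ℝ) : cfTauFn (cfBr a x) = 2 * Real.log (x + a) := by
  rw [cfTauFn, cfBr, one_div, Real.log_inv]; ring

/-- `Δ_ξ(u, v) = Σ_{i ≥ 0} [τ(g_a^{i+1} u) - τ(g_a^{i+1} v)]` for the constant past `ξ = (…, a, a, a)`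
(`T_{ξ_{-i}}^{-1} ∘ ⋯ ∘ T_{ξ_0}^{-1} = g_a^{i+1}`). [cite: MageeOhWinter2019, §4.1 (before Defn. 19)] -/
def cfDelta (a : ℕ) (u v : ℝ) : ℝ := ∑' i : ℕ, (cfTauFn ((cfBr a)^[i + 1] u) - cfTauFn ((cfBr a)^[i + 1] v))

section Delta

variable {a : ℕ} (ha : 1 ≤ a)
include ha

omit ha in
/-- The summand in closed form: `τ(g_a^{i+1} u) - τ(g_a^{i+1} v) = 2 [log (g_a^i u + a) - log (g_a^i v + a)]`.
[folklore] -/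
theorem cfDelta_summand_eq (u v : ℝ) (i : ℕ) :
    cfTauFn ((cfBr a)^[i + 1] u) - cfTauFn ((cfBr a)^[i + 1] v) =
      2 * (Real.log ((cfBr a)^[i] u + a) - Real.log ((cfBr a)^[i] v + a)) := by
  rw [Function.iterate_succ_apply', Function.iterate_succ_apply', cfTauFn_cfBr, cfTauFn_cfBr]; ring

/-- Geometric bound for the summand: `|τ(g_a^{i+1} u) - τ(g_a^{i+1} v)| ≤ 4 (1/2)^i |u - v|`. [folklore] -/
theorem abs_cfDelta_summand_le {u v : ℝ} (hu : u ∈ Icc (0 : ℝ) 1) (hv : v ∈ Icc (0 : ℝ) 1) (i : ℕ) :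
    |cfTauFn ((cfBr a)^[i + 1] u) - cfTauFn ((cfBr a)^[i + 1] v)| ≤ 4 * (1 / 2) ^ i * |u - v| := by
  have h1 : (1 : ℝ) ≤ a := by exact_mod_cast ha
  have hui := iterate_cfBr_mem ha hu i
  have hvi := iterate_cfBr_mem ha hv i
  rw [cfDelta_summand_eq, abs_mul, abs_of_pos (by norm_num : (0 : ℝ) < 2)]
  have h := CfThreshold.abs_log_sub_log_le (a := (cfBr a)^[i] u + a) (b := (cfBr a)^[i] v + a) (by linarith [hui.1])
    (by linarith [hvi.1])
  rw [add_sub_add_right_eq_sub] at h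
  have h' := abs_iterate_sub_le ha hu hv i
  linarith

/-- **`Δ_ξ` converges** for the constant past and `u, v ∈ [0, 1]`. [cite: MageeOhWinter2019, §4.1] -/
theorem summable_cfDelta {u v : ℝ} (hu : u ∈ Icc (0 : ℝ) 1) (hv : v ∈ Icc (0 : ℝ) 1) :
    Summable fun i : ℕ => cfTauFn ((cfBr a)^[i + 1] u) - cfTauFn ((cfBr a)^[i + 1] v) := by
  refine Summable.of_norm_bounded (g := fun i : ℕ => 4 * (1 / 2 : ℝ) ^ i * |u - v|) ?_ fun i => ?_
  · exact ((summable_geometric_of_lt_one (by norm_num) (by norm_num)).mul_left 4).mul_right _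
  · rw [Real.norm_eq_abs]; exact abs_cfDelta_summand_le ha hu hv i

/-- Partial sums telescope: `Σ_{i<n} [τ(g_a^{i+1} u) - τ(g_a^{i+1} v)] =
2[log(u - ω^*) - log(g_a^n u - ω^*)] - 2[log(v - ω^*) - log(g_a^n v - ω^*)]`. [folklore] -/
theorem sum_range_cfDelta_summand {u v : ℝ} (hu : u ∈ Icc (0 : ℝ) 1) (hv : v ∈ Icc (0 : ℝ) 1) (n : ℕ) :
    ∑ i ∈ Finset.range n, (cfTauFn ((cfBr a)^[i + 1] u) - cfTauFn ((cfBr a)^[i + 1] v)) =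
      2 * (Real.log (u - cfOmegaStar a) - Real.log ((cfBr a)^[n] u - cfOmegaStar a)) -
        2 * (Real.log (v - cfOmegaStar a) - Real.log ((cfBr a)^[n] v - cfOmegaStar a)) := by
  have hterm : ∀ i ∈ Finset.range n, cfTauFn ((cfBr a)^[i + 1] u) - cfTauFn ((cfBr a)^[i + 1] v) =
      2 * ((Real.log ((cfBr a)^[i] u - cfOmegaStar a) - Real.log ((cfBr a)^[i + 1] u - cfOmegaStar a)) -
        (Real.log ((cfBr a)^[i] v - cfOmegaStar a) - Real.log ((cfBr a)^[i + 1] v - cfOmegaStar a))) := by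
    intro i _
    rw [cfDelta_summand_eq, mul_sub, two_log_add_eq ha (iterate_cfBr_mem ha hu i).1,
      two_log_add_eq ha (iterate_cfBr_mem ha hv i).1, Function.iterate_succ_apply',
      Function.iterate_succ_apply']
    ring
  rw [Finset.sum_congr rfl hterm, ← Finset.mul_sum, Finset.sum_sub_distrib,
    Finset.sum_range_sub' (fun i => Real.log ((cfBr a)^[i] u - cfOmegaStar a)),
    Finset.sum_range_sub' (fun i => Real.log ((cfBr a)^[i] v - cfOmegaStar a))]
  simp only [Function.iterate_zero_apply]
  ring

/-- **Closed form of `Δ_ξ` (constant past):** `Δ_ξ(u, v) = 2 log (u - ω_a^*) - 2 log (v - ω_a^*)` on `[0, 1]²`.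
(Naud 2005, §2, for the fixed-point argument.) [cite: MageeOhWinter2019, §4.1 and Prop. 20] -/
theorem cfDelta_eq {u v : ℝ} (hu : u ∈ Icc (0 : ℝ) 1) (hv : v ∈ Icc (0 : ℝ) 1) :
    cfDelta a u v = 2 * Real.log (u - cfOmegaStar a) - 2 * Real.log (v - cfOmegaStar a) := by
  have hω := cfOmegaStar_lt ha
  have hsum := (summable_cfDelta ha hu hv).hasSum.tendsto_sum_nat
  -- the tail `log (g^n v - ω^*) - log (g^n u - ω^*)` tends to `0`
  have htail : Tendsto (fun n => Real.log ((cfBr a)^[n] v - cfOmegaStar a) -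
      Real.log ((cfBr a)^[n] u - cfOmegaStar a)) atTop (𝓝 0) := by
    have h0 : Tendsto (fun n => |(cfBr a)^[n] v - (cfBr a)^[n] u|) atTop (𝓝 0) := by
      simpa using (tendsto_iterate_sub ha hv hu).abs
    refine squeeze_zero_norm (fun n => ?_) h0
    rw [Real.norm_eq_abs]
    have h := CfThreshold.abs_log_sub_log_le (a := (cfBr a)^[n] v - cfOmegaStar a)
      (b := (cfBr a)^[n] u - cfOmegaStar a) (by linarith [(iterate_cfBr_mem ha hv n).1])
      (by linarith [(iterate_cfBr_mem ha hu n).1])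
    rwa [sub_sub_sub_cancel_right] at h
  have hlim : Tendsto (fun n => ∑ i ∈ Finset.range n, (cfTauFn ((cfBr a)^[i + 1] u) -
      cfTauFn ((cfBr a)^[i + 1] v))) atTop
      (𝓝 (2 * Real.log (u - cfOmegaStar a) - 2 * Real.log (v - cfOmegaStar a) + 2 * 0)) := by
    refine ((htail.const_mul 2).const_add _).congr fun n => ?_
    rw [sum_range_cfDelta_summand ha hu hv n]; ring
  rw [mul_zero, add_zero] at hlim
  exact tendsto_nhds_unique hsum hlim

end Delta

/-! ### The temporal distance function and (NLI) -/

/-- The **temporal distance function** `φ_{ξ,η}(u, v) = Δ_ξ(u, v) - Δ_η(u, v)` for the constant pasts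
`ξ = (…, a, a)`, `η = (…, b, b)`. [cite: MageeOhWinter2019, §4.1 (before Defn. 19)] -/
def cfTemporal (a b : ℕ) (u v : ℝ) : ℝ := cfDelta a u v - cfDelta b u v

section Temporal

variable {a b : ℕ} (ha : 1 ≤ a) (hb : 1 ≤ b)
include ha hb

/-- **The temporal distance function is the logarithm of a cross-ratio:**
`φ_{ξ,η}(u, v) = 2[log(u - ω_a^*) - log(v - ω_a^*)] - 2[log(u - ω_b^*) - log(v - ω_b^*)]`.
[cite: MageeOhWinter2019, Prop. 20 (proof: "Naud's argument")] -/
theorem cfTemporal_eq {u v : ℝ} (hu : u ∈ Icc (0 : ℝ) 1) (hv : v ∈ Icc (0 : ℝ) 1) :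
    cfTemporal a b u v = 2 * (Real.log (u - cfOmegaStar a) - Real.log (v - cfOmegaStar a)) -
      2 * (Real.log (u - cfOmegaStar b) - Real.log (v - cfOmegaStar b)) := by
  rw [cfTemporal, cfDelta_eq ha hu hv, cfDelta_eq hb hu hv]; ring

/-- **`∂φ_{ξ,η}/∂u (u, v) = 2/(u - ω_a^*) - 2/(u - ω_b^*)`** on `[0, 1]`. [cite: MageeOhWinter2019, Prop. 20] -/
theorem hasDerivWithinAt_cfTemporal {u v : ℝ} (hu : u ∈ Icc (0 : ℝ) 1) (hv : v ∈ Icc (0 : ℝ) 1) :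
    HasDerivWithinAt (fun u => cfTemporal a b u v) (2 / (u - cfOmegaStar a) - 2 / (u - cfOmegaStar b))
      (Icc (0 : ℝ) 1) u := by
  have hωa := cfOmegaStar_lt ha
  have hωb := cfOmegaStar_lt hb
  have hF : HasDerivAt (fun u : ℝ => 2 * (Real.log (u - cfOmegaStar a) - Real.log (v - cfOmegaStar a)) -
      2 * (Real.log (u - cfOmegaStar b) - Real.log (v - cfOmegaStar b)))
      (2 / (u - cfOmegaStar a) - 2 / (u - cfOmegaStar b)) u := by
    have ha' : HasDerivAt (fun u : ℝ => Real.log (u - cfOmegaStar a)) (1 / (u - cfOmegaStar a)) u := by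
      have h := ((hasDerivAt_id u).sub_const (cfOmegaStar a)).log (by simp; linarith [hu.1])
      simpa using h
    have hb' : HasDerivAt (fun u : ℝ => Real.log (u - cfOmegaStar b)) (1 / (u - cfOmegaStar b)) u := by
      have h := ((hasDerivAt_id u).sub_const (cfOmegaStar b)).log (by simp; linarith [hu.1])
      simpa using h
    have h := ((ha'.sub_const (Real.log (v - cfOmegaStar a))).const_mul 2).sub
      ((hb'.sub_const (Real.log (v - cfOmegaStar b))).const_mul 2)
    refine h.congr_deriv ?_
    ring
  exact hF.hasDerivWithinAt.congr_of_mem (fun w hw => cfTemporal_eq ha hb hw hv) hu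

/-- The `u`-derivative `2/(u - ω_a^*) - 2/(u - ω_b^*)` does not vanish on `[0, 1]` when `a ≠ b` (the two
hyperbolic generators have distinct repelling fixed points). [cite: MageeOhWinter2019, Prop. 20] -/
theorem cfTemporal_deriv_ne_zero (hab : a ≠ b) {u : ℝ} (hu : u ∈ Icc (0 : ℝ) 1) :
    2 / (u - cfOmegaStar a) - 2 / (u - cfOmegaStar b) ≠ 0 := by
  have hωa := cfOmegaStar_lt ha
  have hωb := cfOmegaStar_lt hb
  have hne : cfOmegaStar a ≠ cfOmegaStar b := fun h => hab (cfOmegaStar_strictAnti.injective h)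
  have hua : 0 < u - cfOmegaStar a := by linarith [hu.1]
  have hub : 0 < u - cfOmegaStar b := by linarith [hu.1]
  intro h
  rw [sub_eq_zero, div_eq_div_iff hua.ne' hub.ne'] at h
  exact hne (by linarith)

/-- **Non-local integrability of `τ` for the continued-fractions semigroup [MageeOhWinter2019, Prop. 20]:**
for letters `a ≠ b` (`a, b ≥ 1`), the constant pasts `ξ = (…, a, a)`, `η = (…, b, b)` and ANY
`u₀, v₀ ∈ [0, 1]`, the temporal distance function has `∂φ_{ξ,η}/∂u (u₀, v₀) ≠ 0` (Defn. 19 with `I_{j₀}` any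
cylinder: the CF coding is a full shift). [cite: MageeOhWinter2019, Defn. 19, Prop. 20] -/
theorem cfNLI (hab : a ≠ b) {u₀ v₀ : ℝ} (hu : u₀ ∈ Icc (0 : ℝ) 1) (hv : v₀ ∈ Icc (0 : ℝ) 1) :
    ∃ D : ℝ, D ≠ 0 ∧ HasDerivWithinAt (fun u => cfTemporal a b u v₀) D (Icc (0 : ℝ) 1) u₀ :=
  ⟨_, cfTemporal_deriv_ne_zero ha hb hab hu, hasDerivWithinAt_cfTemporal ha hb hu hv⟩

end Temporal

/-- **(NLI) for every alphabet `A ⊂ ℕ_{≥1}` with at least two letters** [MageeOhWinter2019, Prop. 20]: there are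
letters `a ≠ b` of `A` such that for all `u₀, v₀ ∈ [0, 1]` the temporal distance function of the constant pasts
`a^∞`, `b^∞` has non-vanishing `u`-derivative at `(u₀, v₀)`. [cite: MageeOhWinter2019, Prop. 20] -/
theorem cfNLI_of_two_le_card {A : Finset ℕ} (hA : ∀ a ∈ A, 1 ≤ a) (h2 : 2 ≤ A.card) :
    ∃ a ∈ A, ∃ b ∈ A, a ≠ b ∧ ∀ u₀ ∈ Icc (0 : ℝ) 1, ∀ v₀ ∈ Icc (0 : ℝ) 1,
      ∃ D : ℝ, D ≠ 0 ∧ HasDerivWithinAt (fun u => cfTemporal a b u v₀) D (Icc (0 : ℝ) 1) u₀ := by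
  obtain ⟨a, ha, b, hb, hab⟩ := Finset.one_lt_card.1 h2
  exact ⟨a, ha, b, hb, hab, fun u₀ hu v₀ hv => cfNLI (hA a ha) (hA b hb) hab hu hv⟩

end Literature.NumberTheory.Sieve
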